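import Summits.FinalStateConjecture.FinalStateConjecture.Theorems.EIHFluxBalanceModulatedKerrHandoffOneHoleModuli
import Summits.FinalStateConjecture.FinalStateConjecture.Theorems.EIHFluxBalanceInertialRecessionLorentz

/-!
# Route EIHFluxBalance — `ModulatedKerrHandoff`, stub `stub_dragEstimates`: smoothness of the drag terms

Helper file for the crux `stmt-FinalStateConjecture-10167`
(`Summit.FinalStateConjecture.FinalStateConjecture.Theses.EIHFluxBalance.ModulatedKerrHandoff`),
line `overlap-modulation-second-iterate`, stub `stub_dragEstimates` (pure `E4` calculus: the Lie drag of
the modulated multi-Kerr–Schild superposition is below the weight).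

The stub compares the PLAIN modulated superposition `G = η + Σᵢ hᵢ`,
`hᵢ(y) = boostedKerrBilin (Λᵢ(y⁰)) (cᵢ(y⁰)) Mᵢ aᵢ y − η`, `cᵢ(t) = (t, ξᵢ(t))`, with the DRAGGED one
`G⁺ = η + Σᵢ (hᵢ + L_{Xᵢ}hᵢ)`, where `(L_X h)(y) = Dh(y)[A(y − c)] + h(y)(A·, ·) + h(y)(·, A·)` is the Lie
derivative along the affine field `X(y) = A(y − c)` with frozen Jacobian
`A = Aᵢ(y⁰) = ½ η⁻¹ Σ_{j ≠ i} hⱼ(cᵢ(y⁰))` and `Dh` the derivative of the FROZEN-moduli field.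
This file proves the qualitative half:

* `sum_add_sub_sum_eq` — `G⁺ − G = Σᵢ L_{Xᵢ}hᵢ` pointwise (the `hᵢ` cancel);
* `contDiffAt_boostedKerrBilin_family` — `x ↦ boostedKerrBilin (L x) (c x) M a (z x)` is `Cⁿ` along `Cⁿ`
  families of boosts, centres and points wherever the rest-frame Kerr–Schild radius is positive
  (`Kerr.contDiffAt_bilin`, Kerr–Schild 1965 §3, and polynomiality in the inverse boost);
* `contDiffAt_fderiv_frozen` — hence `y ↦ D[h frozen at the moduli of time y⁰](y)[V(y)]` is smooth
  (Mathlib's `ContDiffAt.fderiv` on the jointly smooth `(y, z) ↦ h_{moduli(y⁰)}(z)`);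
* `contDiffAt_dragMatrix` — the drag matrix `t ↦ Aᵢ(t)` is smooth once every other centre is farther
  than its ring radius, `|aⱼ| < ‖ξᵢ(t) − ξⱼ(t)‖` (boosts stretch spatial vectors:
  `sq_sub_sq_le_radius_poincareInv_sq`);
* `contDiffAt_dragged`, `contDiffAt_drag` — smoothness of one dragged summand `hᵢ + L_{Xᵢ}hᵢ` and of
  the drag term `L_{Xᵢ}hᵢ` alone at such times off the core of hole `i`;
* `exists_forall_abs_lt_dist` — under hyperbolic separation that time comes.

No estimates here (they are in the companion `…Drag*` files). [folklore]
-/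

noncomputable section

-- `Summit.<S>.<S>.…` (single-problem summit, D-0017) trips core's duplicate-namespace linter.
set_option linter.dupNamespace false

open Set Filter Function Literature.Geometry.Lorentzian
open scoped Topology ContDiff BigOperators

namespace Summit.FinalStateConjecture.FinalStateConjecture.Theorems

namespace Drag

/-! ### Algebra: the plain summands cancel -/

/-- `(η + Σᵢ (pᵢ + qᵢ)) − (η + Σᵢ pᵢ) = Σᵢ qᵢ` pointwise: the difference of the dragged and the plain
superposition is the sum of the drag terms. [folklore] -/
theorem sum_add_sub_sum_eq {E' G : Type*} [AddCommGroup G] {N : ℕ} (p q : Fin N → E' → G) (η : G) :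
    (fun y ↦ (η + ∑ i, (p i y + q i y)) - (η + ∑ i, p i y)) = fun y ↦ ∑ i, q i y := by
  funext y
  rw [add_sub_add_left_eq_sub, Finset.sum_add_distrib, add_sub_cancel_left]

/-! ### Smoothness along families of boosts, centres and points -/

/-- Along a `Cⁿ` family of Lorentz boosts `x ↦ L(x)` (as operators) the inverse boosts `x ↦ L(x)⁻¹`
are `Cⁿ` (inversion is analytic on the units of `E4 →L E4`). [folklore] -/
theorem contDiffAt_lorentz_symm_family {X : Type*} [NormedAddCommGroup X] [NormedSpace ℝ X]
    {Lf : X → lorentzGroup} {x : X} {n : WithTop ℕ∞}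
    (hL : ContDiffAt ℝ n (fun x ↦ ((Lf x : E4 ≃L[ℝ] E4) : E4 →L[ℝ] E4)) x) :
    ContDiffAt ℝ n (fun x ↦ (((Lf x : E4 ≃L[ℝ] E4).symm : E4 ≃L[ℝ] E4) : E4 →L[ℝ] E4)) x := by
  have h : (fun x ↦ (((Lf x : E4 ≃L[ℝ] E4).symm : E4 ≃L[ℝ] E4) : E4 →L[ℝ] E4)) =
      fun x ↦ ContinuousLinearMap.inverse ((Lf x : E4 ≃L[ℝ] E4) : E4 →L[ℝ] E4) := by
    funext x
    rw [ContinuousLinearMap.inverse_equiv]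
  rw [h]
  exact (contDiffAt_map_inverse (Lf x : E4 ≃L[ℝ] E4)).comp x hL

/-- **The boosted Kerr–Schild form along smooth families.** If `x ↦ L(x)` (boosts, as operators),
`x ↦ c(x)` (centres) and `x ↦ z(x)` (points) are `Cⁿ` at `x₀` and the rest-frame Kerr–Schild radius of
`L(x₀)⁻¹(z(x₀) − c(x₀))` is positive, then `x ↦ boostedKerrBilin (L x) (c x) M a (z x)` is `Cⁿ` at `x₀`:
the Kerr–Schild components are smooth off the ring (`Kerr.contDiffAt_bilin`, Kerr–Schild 1965, §3) and
`(T, θ) ↦ T(θ·, θ·)` is polynomial. [cite: KerrSchild1965, §3] -/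
theorem contDiffAt_boostedKerrBilin_family {X : Type*} [NormedAddCommGroup X] [NormedSpace ℝ X]
    {Lf : X → lorentzGroup} {cf zf : X → E4} (M a : ℝ) {x : X} {n : WithTop ℕ∞}
    (hL : ContDiffAt ℝ n (fun x ↦ ((Lf x : E4 ≃L[ℝ] E4) : E4 →L[ℝ] E4)) x)
    (hc : ContDiffAt ℝ n cf x) (hz : ContDiffAt ℝ n zf x)
    (hr : 0 < Kerr.radius a (poincareInv (Lf x) (cf x) (zf x))) :
    ContDiffAt ℝ n (fun x ↦ boostedKerrBilin (Lf x) (cf x) M a (zf x)) x := by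
  have hθ := contDiffAt_lorentz_symm_family hL
  have hw : ContDiffAt ℝ n
      (fun x ↦ (((Lf x : E4 ≃L[ℝ] E4).symm : E4 ≃L[ℝ] E4) : E4 →L[ℝ] E4) (zf x - cf x)) x :=
    hθ.clm_apply (hz.sub hc)
  have hK : ContDiffAt ℝ n (fun x ↦ Kerr.bilin M a
      ((((Lf x : E4 ≃L[ℝ] E4).symm : E4 ≃L[ℝ] E4) : E4 →L[ℝ] E4) (zf x - cf x))) x :=
    ContDiffAt.comp (f := fun x ↦ (((Lf x : E4 ≃L[ℝ] E4).symm : E4 ≃L[ℝ] E4) : E4 →L[ℝ] E4)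
      (zf x - cf x)) x (Kerr.contDiffAt_bilin M a hr) hw
  have hB := contDiffWithinAt_bilinearComp_self (s := Set.univ) hK.contDiffWithinAt
    hθ.contDiffWithinAt
  rw [contDiffWithinAt_univ] at hB
  refine hB.congr_of_eventuallyEq (Eventually.of_forall fun y ↦ ?_)
  show boostedKerrBilin (Lf y) (cf y) M a (zf y) =
    (Kerr.bilin M a ((((Lf y : E4 ≃L[ℝ] E4).symm : E4 ≃L[ℝ] E4) : E4 →L[ℝ] E4) (zf y - cf y))).bilinearComp
      (((Lf y : E4 ≃L[ℝ] E4).symm : E4 ≃L[ℝ] E4) : E4 →L[ℝ] E4)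
      (((Lf y : E4 ≃L[ℝ] E4).symm : E4 ≃L[ℝ] E4) : E4 →L[ℝ] E4)
  rw [bilinearComp_self_eq_comp]
  rfl

/-- `precomp ℝ L = (compL ℝ E4 E4 ℝ).flip L`: pre-composition as a value of a FIXED continuous bilinear
operator (so that it can be differentiated in `L`). [folklore] -/
theorem precomp_eq_compL_flip (L : E4 →L[ℝ] E4) :
    ContinuousLinearMap.precomp ℝ L = (ContinuousLinearMap.compL ℝ E4 E4 ℝ).flip L := by
  ext φ v
  simp

/-- Pre-composition `(precomp ℝ (f x)).comp (g x) = g(x)(·, f(x)·)` is `Cⁿ` along `Cⁿ` operator-valued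
`f` and form-valued `g` (it is bilinear in `(f, g)`). [folklore] -/
theorem contDiffAt_precomp_comp {X : Type*} [NormedAddCommGroup X] [NormedSpace ℝ X]
    {f : X → E4 →L[ℝ] E4} {g : X → E4 →L[ℝ] E4 →L[ℝ] ℝ} {x : X} {n : WithTop ℕ∞}
    (hf : ContDiffAt ℝ n f x) (hg : ContDiffAt ℝ n g x) :
    ContDiffAt ℝ n (fun x ↦ (ContinuousLinearMap.precomp ℝ (f x)).comp (g x)) x := by
  have he : (fun x ↦ (ContinuousLinearMap.precomp ℝ (f x)).comp (g x)) =
      fun x ↦ ((ContinuousLinearMap.compL ℝ E4 E4 ℝ).flip (f x)).comp (g x) :=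
    funext fun x ↦ by rw [precomp_eq_compL_flip]
  rw [he]
  have h2 := ContDiffAt.continuousLinearMap_comp (G := (E4 →L[ℝ] ℝ) →L[ℝ] (E4 →L[ℝ] ℝ))
    ((ContinuousLinearMap.compL ℝ E4 E4 ℝ).flip) hf
  exact h2.clm_comp hg

/-! ### The frozen-moduli derivative along a smooth vector field -/

section Moduli

variable {Λ : ℝ → lorentzGroup} {ξ : ℝ → E3}

/-- The lab time `y ↦ y⁰` is smooth. [folklore] -/
theorem contDiff_time {n : WithTop ℕ∞} : ContDiff ℝ n (fun y : E4 ↦ y 0) :=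
  (EuclideanSpace.proj (0 : Fin 4) (𝕜 := ℝ)).contDiff

/-- **The frozen-moduli derivative is smooth.** For smooth moduli and a smooth field `V`, the map
`y ↦ D[z ↦ boostedKerrBilin (Λ(y⁰)) (c(y⁰)) M a z − η](y)[V(y)]` (derivative in the point with the
moduli FROZEN at lab time `y⁰`, then evaluated along `y`) is `C^∞` at every `x` of positive
instantaneous rest-frame radius: `(y, z) ↦ boostedKerrBilin (Λ(y⁰)) (c(y⁰)) M a z` is jointly smooth
near `(x, x)` (`contDiffAt_boostedKerrBilin_family`) and Mathlib's `ContDiffAt.fderiv` applies.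
[folklore] -/
theorem contDiffAt_fderiv_frozen (M a : ℝ) {V : E4 → E4} {x : E4}
    (hΛ : ContDiff ℝ ∞ (fun t ↦ ((Λ t : E4 ≃L[ℝ] E4) : E4 →L[ℝ] E4))) (hξ : ContDiff ℝ ∞ ξ)
    (hV : ContDiffAt ℝ ∞ V x)
    (hx : 0 < Kerr.radius a (poincareInv (Λ (x 0)) (E4.ofTimeSpace (x 0) (ξ (x 0))) x)) :
    ContDiffAt ℝ ∞ (fun y ↦ fderiv ℝ (fun z ↦ boostedKerrBilin (Λ (y 0)) (E4.ofTimeSpace (y 0) (ξ (y 0)))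
      M a z - Minkowski.bilin) y (V y)) x := by
  have h1 : ContDiff ℝ ∞ (fun p : E4 × E4 ↦ p.1 0) := contDiff_time.comp contDiff_fst
  have hL : ContDiffAt ℝ ∞ (fun p : E4 × E4 ↦ ((Λ (p.1 0) : E4 ≃L[ℝ] E4) : E4 →L[ℝ] E4)) (x, x) :=
    (hΛ.comp h1).contDiffAt
  have hc : ContDiffAt ℝ ∞ (fun p : E4 × E4 ↦ E4.ofTimeSpace (p.1 0) (ξ (p.1 0))) (x, x) :=
    ((contDiff_centreEvent hξ).comp contDiff_fst).contDiffAt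
  have hunc : ContDiffAt ℝ ∞ (Function.uncurry fun (y z : E4) ↦
      boostedKerrBilin (Λ (y 0)) (E4.ofTimeSpace (y 0) (ξ (y 0))) M a z - Minkowski.bilin) (x, x) :=
    (contDiffAt_boostedKerrBilin_family (Lf := fun p : E4 × E4 ↦ Λ (p.1 0))
      (cf := fun p : E4 × E4 ↦ E4.ofTimeSpace (p.1 0) (ξ (p.1 0))) (zf := fun p : E4 × E4 ↦ p.2)
      M a hL hc contDiffAt_snd hx).sub contDiffAt_const
  have hD := hunc.fderiv (contDiffAt_id (x := x)) (m := ∞) (le_of_eq (by norm_cast))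
  exact hD.clm_apply hV

/-- The plain summand `y ↦ boostedKerrBilin (Λ(y⁰)) (c(y⁰)) M a y − η` is smooth off the ring
(`contDiffAt_boostedKerrBilin_modulated`). [folklore] -/
theorem contDiffAt_plain (M a : ℝ) {x : E4}
    (hΛ : ContDiff ℝ ∞ (fun t ↦ ((Λ t : E4 ≃L[ℝ] E4) : E4 →L[ℝ] E4))) (hξ : ContDiff ℝ ∞ ξ)
    (hx : 0 < Kerr.radius a (poincareInv (Λ (x 0)) (E4.ofTimeSpace (x 0) (ξ (x 0))) x)) :
    ContDiffAt ℝ ∞ (fun y ↦ boostedKerrBilin (Λ (y 0)) (E4.ofTimeSpace (y 0) (ξ (y 0))) M a y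
      - Minkowski.bilin) x :=
  (contDiffAt_boostedKerrBilin_modulated M a hΛ hξ hx).sub contDiffAt_const

end Moduli

/-! ### The drag matrix -/

section Matrix

variable {N : ℕ} {M a : Fin N → ℝ} {Λ : Fin N → ℝ → lorentzGroup} {ξ : Fin N → ℝ → E3}

/-- **The other holes' fields are smooth at this hole's centre once the centres are farther apart
than the ring radii.** If `|aⱼ| < ‖ξᵢ(t₀) − ξⱼ(t₀)‖` then the rest-frame Kerr–Schild radius of the
event `cᵢ(t₀)` with respect to hole `j` is positive (`r² ≥ d² − a²`: boosts stretch spatial vectors,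
`sq_sub_sq_le_radius_poincareInv_sq`). [folklore] -/
theorem radius_pos_of_abs_lt_dist {i j : Fin N} {t₀ : ℝ} (h : |a j| < ‖ξ i t₀ - ξ j t₀‖) :
    0 < Kerr.radius (a j) (poincareInv (Λ j t₀) (E4.ofTimeSpace t₀ (ξ j t₀))
      (E4.ofTimeSpace t₀ (ξ i t₀))) := by
  have h1 := sq_sub_sq_le_radius_poincareInv_sq (Λ j t₀) (a j) t₀ (ξ j t₀)
    (x := E4.ofTimeSpace t₀ (ξ i t₀)) (E4.ofTimeSpace_apply_zero t₀ _)
  rw [E4.spatial_ofTimeSpace] at h1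
  have h2 : a j ^ 2 < ‖ξ i t₀ - ξ j t₀‖ ^ 2 := by
    rw [← sq_abs (a j)]
    exact pow_lt_pow_left₀ h (abs_nonneg _) two_ne_zero
  have h3 := Kerr.radius_nonneg (a j) (poincareInv (Λ j t₀) (E4.ofTimeSpace t₀ (ξ j t₀))
    (E4.ofTimeSpace t₀ (ξ i t₀)))
  nlinarith

/-- **The drag matrix is smooth once the centres have separated.**
`t ↦ Aᵢ(t) = ½ η⁻¹ Σ_{j ≠ i} (boostedKerrBilin (Λⱼ t) (cⱼ t) Mⱼ aⱼ (cᵢ t) − η)` is `C^∞` at every `t₀`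
with `|aⱼ| < ‖ξᵢ(t₀) − ξⱼ(t₀)‖` for all `j ≠ i` (each summand by `contDiffAt_boostedKerrBilin_family`
along the centre curves). [folklore] -/
theorem contDiffAt_dragMatrix (hΛ : ∀ j, ContDiff ℝ ∞ (fun t ↦ ((Λ j t : E4 ≃L[ℝ] E4) : E4 →L[ℝ] E4)))
    (hξ : ∀ j, ContDiff ℝ ∞ (ξ j)) {i : Fin N} {t₀ : ℝ}
    (hsep : ∀ j, j ≠ i → |a j| < ‖ξ i t₀ - ξ j t₀‖) :
    ContDiffAt ℝ ∞ (fun t ↦ (2⁻¹ : ℝ) • ((Minkowski.bilin : E4 →L[ℝ] E4 →L[ℝ] ℝ).inverse.comp (∑ j ∈ Finset.univ.erase i, (boostedKerrBilin (Λ j t) (E4.ofTimeSpace t (ξ j t)) (M j) (a j) (E4.ofTimeSpace t (ξ i t)) - Minkowski.bilin)))) t₀ := by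
  have hs : ∀ j ∈ Finset.univ.erase i, ContDiffAt ℝ ∞ (fun t ↦ boostedKerrBilin (Λ j t)
      (E4.ofTimeSpace t (ξ j t)) (M j) (a j) (E4.ofTimeSpace t (ξ i t)) - Minkowski.bilin) t₀ := by
    intro j hj
    have hji : j ≠ i := Finset.ne_of_mem_erase hj
    have h := contDiffAt_boostedKerrBilin_family (Lf := fun t ↦ Λ j t)
      (cf := fun t ↦ E4.ofTimeSpace t (ξ j t)) (zf := fun t ↦ E4.ofTimeSpace t (ξ i t)) (M j) (a j)
      (x := t₀) (hΛ j).contDiffAt (OneHole.contDiff_centre (hξ j)).contDiffAt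
      (OneHole.contDiff_centre (hξ i)).contDiffAt (radius_pos_of_abs_lt_dist (hsep j hji))
    exact h.sub contDiffAt_const
  have h1 : ContDiffAt ℝ ∞ (fun t ↦ ∑ j ∈ Finset.univ.erase i, (boostedKerrBilin (Λ j t)
      (E4.ofTimeSpace t (ξ j t)) (M j) (a j) (E4.ofTimeSpace t (ξ i t)) - Minkowski.bilin)) t₀ :=
    ContDiffAt.sum hs
  have h2 := (contDiffAt_const (c := (Minkowski.bilin : E4 →L[ℝ] E4 →L[ℝ] ℝ).inverse)).clm_comp h1
  exact h2.const_smul (2⁻¹ : ℝ)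

/-- **One dragged summand `hᵢ + L_{Xᵢ}hᵢ` is smooth** at every point `x` off the core of hole `i`
(positive instantaneous rest-frame radius) whose lab time separates the centres
(`|aⱼ| < ‖ξᵢ(x⁰) − ξⱼ(x⁰)‖`, `j ≠ i`). [folklore] -/
theorem contDiffAt_dragged (hΛ : ∀ j, ContDiff ℝ ∞ (fun t ↦ ((Λ j t : E4 ≃L[ℝ] E4) : E4 →L[ℝ] E4)))
    (hξ : ∀ j, ContDiff ℝ ∞ (ξ j)) {i : Fin N} {x : E4}
    (hsep : ∀ j, j ≠ i → |a j| < ‖ξ i (x 0) - ξ j (x 0)‖)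
    (hx : 0 < Kerr.radius (a i) (poincareInv (Λ i (x 0)) (E4.ofTimeSpace (x 0) (ξ i (x 0))) x)) :
    ContDiffAt ℝ ∞ (fun x ↦ (boostedKerrBilin (Λ i (x 0)) (E4.ofTimeSpace (x 0) (ξ i (x 0))) (M i) (a i) x - Minkowski.bilin) + (fderiv ℝ (fun z ↦ boostedKerrBilin (Λ i (x 0)) (E4.ofTimeSpace (x 0) (ξ i (x 0))) (M i) (a i) z - Minkowski.bilin) x (((2⁻¹ : ℝ) • ((Minkowski.bilin : E4 →L[ℝ] E4 →L[ℝ] ℝ).inverse.comp (∑ j ∈ Finset.univ.erase i, (boostedKerrBilin (Λ j (x 0)) (E4.ofTimeSpace (x 0) (ξ j (x 0))) (M j) (a j) (E4.ofTimeSpace (x 0) (ξ i (x 0))) - Minkowski.bilin)))) (x - (E4.ofTimeSpace (x 0) (ξ i (x 0))))) + (boostedKerrBilin (Λ i (x 0)) (E4.ofTimeSpace (x 0) (ξ i (x 0))) (M i) (a i) x - Minkowski.bilin).comp ((2⁻¹ : ℝ) • ((Minkowski.bilin : E4 →L[ℝ] E4 →L[ℝ] ℝ).inverse.comp (∑ j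 ∈ Finset.univ.erase i, (boostedKerrBilin (Λ j (x 0)) (E4.ofTimeSpace (x 0) (ξ j (x 0))) (M j) (a j) (E4.ofTimeSpace (x 0) (ξ i (x 0))) - Minkowski.bilin)))) + (ContinuousLinearMap.precomp ℝ ((2⁻¹ : ℝ) • ((Minkowski.bilin : E4 →L[ℝ] E4 →L[ℝ] ℝ).inverse.comp (∑ j ∈ Finset.univ.erase i, (boostedKerrBilin (Λ j (x 0)) (E4.ofTimeSpace (x 0) (ξ j (x 0))) (M j) (a j) (E4.ofTimeSpace (x 0) (ξ i (x 0))) - Minkowski.bilin))))).comp (boostedKerrBilin (Λ i (x 0)) (E4.ofTimeSpace (x 0) (ξ i (x 0))) (M i) (a i) x - Minkowski.bilin))) x := by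
  have hA := (contDiffAt_dragMatrix (M := M) hΛ hξ hsep).comp x contDiff_time.contDiffAt
  have hh := contDiffAt_plain (M i) (a i) (hΛ i) (hξ i) hx
  have hV : ContDiffAt ℝ ∞ (fun y : E4 ↦ y - E4.ofTimeSpace (y 0) (ξ i (y 0))) x :=
    contDiffAt_id.sub (contDiff_centreEvent (hξ i)).contDiffAt
  have hAV := hA.clm_apply hV
  have hT1 := contDiffAt_fderiv_frozen (M i) (a i) (hΛ i) (hξ i) hAV hx
  have hT2 := hh.clm_comp hA
  have hT3 := contDiffAt_precomp_comp hA hh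
  have hT := (hT1.add hT2).add hT3
  exact hh.add hT

/-- **The drag term `L_{Xᵢ}hᵢ` alone is smooth** under the same hypotheses. [folklore] -/
theorem contDiffAt_drag (hΛ : ∀ j, ContDiff ℝ ∞ (fun t ↦ ((Λ j t : E4 ≃L[ℝ] E4) : E4 →L[ℝ] E4)))
    (hξ : ∀ j, ContDiff ℝ ∞ (ξ j)) {i : Fin N} {x : E4}
    (hsep : ∀ j, j ≠ i → |a j| < ‖ξ i (x 0) - ξ j (x 0)‖)
    (hx : 0 < Kerr.radius (a i) (poincareInv (Λ i (x 0)) (E4.ofTimeSpace (x 0) (ξ i (x 0))) x)) :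
    ContDiffAt ℝ ∞ (fun x ↦ fderiv ℝ (fun z ↦ boostedKerrBilin (Λ i (x 0)) (E4.ofTimeSpace (x 0) (ξ i (x 0))) (M i) (a i) z - Minkowski.bilin) x (((2⁻¹ : ℝ) • ((Minkowski.bilin : E4 →L[ℝ] E4 →L[ℝ] ℝ).inverse.comp (∑ j ∈ Finset.univ.erase i, (boostedKerrBilin (Λ j (x 0)) (E4.ofTimeSpace (x 0) (ξ j (x 0))) (M j) (a j) (E4.ofTimeSpace (x 0) (ξ i (x 0))) - Minkowski.bilin)))) (x - (E4.ofTimeSpace (x 0) (ξ i (x 0))))) + (boostedKerrBilin (Λ i (x 0)) (E4.ofTimeSpace (x 0) (ξ i (x 0))) (M i) (a i) x - Minkowski.bilin).comp ((2⁻¹ : ℝ) • ((Minkowski.bilin : E4 →L[ℝ] E4 →L[ℝ] ℝ).inverse.comp (∑ j ∈ Finset.univ.erase i, (boostedKerrBilin (Λ j (x 0)) (E4.ofTimeSpace (x 0) (ξ j (x 0))) (M j) (a j) (E4.ofTimeSpace (x 0) (ξ i (x 0))) - Minkowski.bilin)))) + (ContinuousLinearMap.precomp ℝ ((2⁻¹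 : ℝ) • ((Minkowski.bilin : E4 →L[ℝ] E4 →L[ℝ] ℝ).inverse.comp (∑ j ∈ Finset.univ.erase i, (boostedKerrBilin (Λ j (x 0)) (E4.ofTimeSpace (x 0) (ξ j (x 0))) (M j) (a j) (E4.ofTimeSpace (x 0) (ξ i (x 0))) - Minkowski.bilin))))).comp (boostedKerrBilin (Λ i (x 0)) (E4.ofTimeSpace (x 0) (ξ i (x 0))) (M i) (a i) x - Minkowski.bilin)) x := by
  have hA := (contDiffAt_dragMatrix (M := M) hΛ hξ hsep).comp x contDiff_time.contDiffAt
  have hh := contDiffAt_plain (M i) (a i) (hΛ i) (hξ i) hx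
  have hV : ContDiffAt ℝ ∞ (fun y : E4 ↦ y - E4.ofTimeSpace (y 0) (ξ i (y 0))) x :=
    contDiffAt_id.sub (contDiff_centreEvent (hξ i)).contDiffAt
  have hAV := hA.clm_apply hV
  have hT1 := contDiffAt_fderiv_frozen (M i) (a i) (hΛ i) (hξ i) hAV hx
  have hT2 := hh.clm_comp hA
  have hT3 := contDiffAt_precomp_comp hA hh
  exact (hT1.add hT2).add hT3

end Matrix

/-! ### Hyperbolic separation gives the separating time -/

/-- Under hyperbolic separation (`v t ≤ ‖ξᵢ(t) − ξⱼ(t)‖` eventually, `v > 0`) and for any bounds `bⱼ`,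
eventually `bⱼ < ‖ξᵢ(t) − ξⱼ(t)‖` simultaneously for all pairs `i ≠ j` (finitely many pairs).
[folklore] -/
theorem eventually_forall_lt_dist {N : ℕ} {ξ : Fin N → ℝ → E3}
    (hhyp : ∀ i j, i ≠ j → ∃ v : ℝ, 0 < v ∧ ∀ᶠ t in atTop, v * t ≤ ‖ξ i t - ξ j t‖) (b : Fin N → ℝ) :
    ∀ᶠ t in atTop, ∀ i j, i ≠ j → b j < ‖ξ i t - ξ j t‖ := by
  refine eventually_all.mpr fun i ↦ eventually_all.mpr fun j ↦ ?_
  by_cases hij : i = j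
  · exact Eventually.of_forall fun t h ↦ (h hij).elim
  · obtain ⟨v, hv, hvt⟩ := hhyp i j hij
    filter_upwards [hvt, eventually_gt_atTop (b j / v)] with t ht ht' _
    rw [div_lt_iff₀ hv] at ht'
    linarith

/-- Hence there is a lab time `T` after which every other centre is outside every ring radius:
`∀ t > T, ∀ i ≠ j, |aⱼ| < ‖ξᵢ(t) − ξⱼ(t)‖`. [folklore] -/
theorem exists_forall_abs_lt_dist {N : ℕ} {ξ : Fin N → ℝ → E3} (a : Fin N → ℝ)
    (hhyp : ∀ i j, i ≠ j → ∃ v : ℝ, 0 < v ∧ ∀ᶠ t in atTop, v * t ≤ ‖ξ i t - ξ j t‖) :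
    ∃ T : ℝ, ∀ t, T < t → ∀ i j, i ≠ j → |a j| < ‖ξ i t - ξ j t‖ := by
  obtain ⟨T, hT⟩ := eventually_atTop.mp (eventually_forall_lt_dist hhyp fun j ↦ |a j|)
  exact ⟨T, fun t ht ↦ hT t ht.le⟩

end Drag

/-- Registered sub-goal form (stub `drag_sum_add_sub_sum_eq` of the crux item) of
`Drag.sum_add_sub_sum_eq`: the dragged minus the plain superposition is the sum of the drag terms.
[folklore] -/
theorem drag_sum_add_sub_sum_eq : ∀ {E' G : Type*} [AddCommGroup G] {N : ℕ} (p q : Fin N → E' → G) (η : G), (fun y ↦ (η + ∑ i, (p i y + q i y)) - (η + ∑ i, p i y)) = fun y ↦ ∑ i, q i y :=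
  fun p q η ↦ Drag.sum_add_sub_sum_eq p q η

end Summit.FinalStateConjecture.FinalStateConjecture.Theorems

end
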